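import Summits.BirchSwinnertonDyer.BirchSwinnertonDyer.Theorems.KolyvaginRoadThreeZhangSupplyLocalH1Card
import Summits.BirchSwinnertonDyer.BirchSwinnertonDyer.Theorems.KolyvaginRoadThreeMethod2KolyvaginLocalFrobenius
import HarnessLib

/-!
# Route `KolyvaginRoadThree`, deciding crux `ZhangSharpFrameAtThreeHL` (item stmt-BirchSwinnertonDyer-19574):
# `#H¹(K_λ, E[3]) = 81` at a Zhang–Kolyvagin prime, UNCONDITIONALLY — the binder `hw` of `hjump_of_lagrangian` discharged
# (cell `bsd-stepL`, ACCEL seat `bsd-stepL-koly3b` g5; `--supports stmt-BirchSwinnertonDyer-19574`, helper; part XVII of the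
# `KolyvaginRoadThreeZhangSupply*` series = part XV ∘ zhang3-p1 g9's `KolyLocal.decompositionSubgroup_le_torsionFixing`)

HONEST FRAMING. Theorems only; 0 definitions, 0 named facts, 0 `sorry`; closes nothing (T7). PARTITION: O2@3 (B10) × A1 ×
crux 19574 × the S2-ENGINE's (Supply) binder — proves-glue.

WHAT. For `K` imaginary quadratic, `E = W/ℚ`, `ℓ` a Kolyvagin prime at `3` in W. Zhang's sense (`Zhang2014.IsKolyvaginPrime`)
and `λ ∋ ℓ` its place: the decomposition group of the prime of `ℤ̄_K` cut out by the chosen embedding `K̄ → K̄_λ` fixes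
`E[3]` (zhang3-p1 g9, p509901: Cayley–Hamilton `Frob_ℓ² = 1` on `E[3]` from `3 ∣ a_ℓ`, `3 ∣ ℓ + 1`, inertia by good
reduction), hence `Γ_{K_λ}` fixes `E[3]`, `#E(K_λ)[3] = 9` and `#H¹(K_λ, E[3]) = 81 > 9` (part XV's argument, Milne I
Thm. 2.8 via n1011 `LocalH1UnramifiedSquare`). `nine_lt_natCard_galoisCohomology_one_toLocal_of_kolyvagin` is the binder
`hw` of part XIV `hjump_of_lagrangian` at `w = λ`, with no hypothesis left.

References: [cite: MilneADT2006, Ch. I, Thm. 2.8] [cite: GrossLMS1991, §3 (3.3)] [cite: WZhang2014, Notations (xii)]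
[cite: NeukirchANT1999, Ch. II §9 (9.6)].
-/

noncomputable section

open scoped Classical Pointwise

namespace Summit.BirchSwinnertonDyer.Rank1Residual.X11b.Three.Koly.ZhangSupply

open CategoryTheory WeierstrassCurve Field Function NumberField IsDedekindDomain
open Literature.NumberTheory.EllipticCurves Literature.NumberTheory.GaloisRepresentations
open Summit.BirchSwinnertonDyer.Rank1Residual.GaloisImage
  Summit.BirchSwinnertonDyer.Rank1Residual.GaloisImage.LocalH1UnramifiedSquare
open Summit.BirchSwinnertonDyer.Rank1Residual.X11b.Three.Koly.Method2

variable (W : WeierstrassCurve ℚ) (K : Type) [Field K] [NumberField K] [W.IsElliptic] [W.IsGloballyMinimal]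

/-- **At a Kolyvagin prime every `3`-torsion point is `K_λ`-rational**: the invariants of `Γ_{K_λ}` on `E[3](K̄)` number `9`.
[cite: GrossLMS1991, §3 (3.3)] [cite: NeukirchANT1999, Ch. II §9 (9.6)] -/
theorem natCard_invariants_eq_nine_of_kolyvagin (hK : IsImaginaryQuadratic K) {ℓ : ℕ}
    (hℓ : Zhang2014.IsKolyvaginPrime (W.conductorNorm ℤ) W K 3 ℓ) (v : HeightOneSpectrum (𝓞 K))
    (hv : (ℓ : 𝓞 K) ∈ v.asIdeal) :
    Nat.card (GaloisRep.restrictField (v.adicCompletion K)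
      ((W.baseChange K).torsionGaloisModule ((3 ^ 1 : ℕ) : ℤ))).toTopRep.ρ.invariants = 9 := by
  set ι₀ := closureEmb (K := K) (v.adicCompletion K) with hι₀
  obtain ⟨𝔐, h𝔐⟩ := v.localPrimesAbove_nonempty
  have hD := KolyLocal.decompositionSubgroup_le_torsionFixing W K hK hℓ v hv h𝔐
  set H := (GaloisRep.restrictField (v.adicCompletion K)
      ((W.baseChange K).torsionGaloisModule ((3 ^ 1 : ℕ) : ℤ))).toTopRep.ρ.invariants with hHdef
  have htop : ∀ Q : geomTorsion (W.baseChange K) ((3 ^ 1 : ℕ) : ℤ), Q ∈ H := by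
    intro Q
    refine (ContRepresentation.mem_invariants _).mpr fun σ ↦ ?_
    have hσ : resGal (K := K) (v.adicCompletion K) σ ∈
        (v.primeBelow ι₀ 𝔐).decompositionSubgroup (absoluteGaloisGroup K) := by
      rw [resGal_eq]; exact resGalOfEmb_mem_decompositionSubgroup ι₀ h𝔐 σ
    have hfix := smul_eq_of_mem_torsionFixing (W.baseChange K) ((3 ^ 1 : ℕ) : ℤ) (hD hσ) Q
    change absGaloisRestrict K (v.adicCompletion K) σ • Q = Q
    rwa [← resGal_eq_absGaloisRestrict]
  have h9 : Nat.card (geomTorsion (W.baseChange K) ((3 ^ 1 : ℕ) : ℤ)) = 9 := by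
    rw [natCard_geomTorsion (W.baseChange K) ((3 ^ 1 : ℕ) : ℤ) (by norm_num)]
    norm_num
  have hHtop : H.toAddSubgroup = ⊤ := by
    rw [eq_top_iff]
    intro Q _
    exact htop Q
  change Nat.card H.toAddSubgroup = 9
  rw [hHtop, AddSubgroup.card_top, h9]

/-- **`#H¹(K_λ, E[3]) = 81` at a Kolyvagin prime** (Milne I Thm. 2.8 with `#E(K_λ)[3] = 9`).
[cite: MilneADT2006, Ch. I, Thm. 2.8] [cite: GrossLMS1991, §3 (3.3)] -/
theorem natCard_galoisCohomology_one_toLocal_eq_of_kolyvagin (hK : IsImaginaryQuadratic K) {ℓ : ℕ}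
    (hℓ : Zhang2014.IsKolyvaginPrime (W.conductorNorm ℤ) W K 3 ℓ) (v : HeightOneSpectrum (𝓞 K))
    (hv : (ℓ : 𝓞 K) ∈ v.asIdeal) :
    Nat.card (galoisCohomology (((W.baseChange K).torsionGaloisModule ((3 ^ 1 : ℕ) : ℤ)).toLocal (Sum.inr v)) 1) = 81 := by
  haveI : Fact (3 : ℕ).Prime := ⟨Nat.prime_three⟩
  haveI : CharZero (v.adicCompletion K) := charZero_of_injective_algebraMap (algebraMap K _).injective
  have h3v : ((3 : ℕ) : 𝓞 K) ∉ v.asIdeal := by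
    have h := (KolyLocal.hasGoodReductionAt_of_kolyvagin W K hℓ v hv).2
    rwa [Int.cast_natCast] at h
  have h1 := natCard_galoisCohomology_one_primeTorsion_adicCompletion_eq_sq_of_not_mem (W.baseChange K) v 3 h3v
  have h0 := natCard_invariants_torsion_restrictField (W.baseChange K) (v.adicCompletion K) (n := 3) (by norm_num)
  have h9 := natCard_invariants_eq_nine_of_kolyvagin W K hK hℓ v hv
  change Nat.card (galoisCohomology
    (GaloisRep.restrictField (v.adicCompletion K) ((W.baseChange K).torsionGaloisModule ((3 : ℕ) : ℤ))) 1) = 81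
  change Nat.card (GaloisRep.restrictField (v.adicCompletion K)
      ((W.baseChange K).torsionGaloisModule ((3 : ℕ) : ℤ))).toTopRep.ρ.invariants = 9 at h9
  rw [h1, ← h0, h9]
  norm_num

/-- **`9 < #H¹(K_λ, E[3])` at a Kolyvagin prime** — the binder `hw` of `hjump_of_lagrangian`, DISCHARGED.
[cite: MilneADT2006, Ch. I, Thm. 2.8] [cite: GrossLMS1991, §3 (3.3)] -/
theorem nine_lt_natCard_galoisCohomology_one_toLocal_of_kolyvagin (hK : IsImaginaryQuadratic K) {ℓ : ℕ}
    (hℓ : Zhang2014.IsKolyvaginPrime (W.conductorNorm ℤ) W K 3 ℓ) (v : HeightOneSpectrum (𝓞 K))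
    (hv : (ℓ : 𝓞 K) ∈ v.asIdeal) :
    (3 ^ 1 : ℕ) ^ 2 <
      Nat.card (galoisCohomology (((W.baseChange K).torsionGaloisModule ((3 ^ 1 : ℕ) : ℤ)).toLocal (Sum.inr v)) 1) := by
  rw [natCard_galoisCohomology_one_toLocal_eq_of_kolyvagin W K hK hℓ v hv]
  norm_num

end Summit.BirchSwinnertonDyer.Rank1Residual.X11b.Three.Koly.ZhangSupply

end
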